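import Summits.ResolutionOfSingularities.ResolutionOfSingularities.Theorems.WeightedInvariantHypersurfaceLocalGameEFTPointMoveChart
import Summits.ResolutionOfSingularities.ResolutionOfSingularities.Theorems.WeightedInvariantOrderNonIncrease
import HarnessLib

/-!
# «ν does not rise», cylinder centres: the exceptional chart `B/(t⁻¹) ≅ (S/(u))[X]` for a PARTIAL regular system of
# parameters and the order bound at every successor point (ORDER (o33-a), regime P3a included)

Topic: `Summits/ResolutionOfSingularities/ResolutionOfSingularities/Theorems`. Helper for the door item
`HypersurfaceCentreConstruction` (statement `stmt-ResolutionOfSingularities-19897`, route `WeightedInvariant`), line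
`local-engine` of res-L1-w43-plan-1 (L W4.3), ORDER (o33-a) of `IOTA3-DESIGN.md` v1 §5, part 3: the same statement as
`…OrderNonIncrease` (point / flag centres, p530559) for centres of POSITIVE dimension — `u : Fin k → S` is only PART of a
regular system of parameters of the regular local ring `S` (linearly independent in the cotangent space), all its
weights are positive, and the weight-`0` «cylinder directions» live in the regular local ring `A = S/(u)` (the local
ring of the centre), which is no longer a field.  This is the shape of the P3a cylinder rule of ORDER (o28)
(`ContactCylinder.jCylinder`, res-type-005 p524206): the centre is the permissible curve `V(x, g)` with weights `(1, b)`.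

* `rho` — the exceptional chart `B → B/(t⁻¹) ≅ (S/(u))[X₁, …, X_k]` for a partial system (`uᵢ' ↦ Xᵢ`, `a ↦ ā`,
  `t⁻¹ ↦ 0`; surjective, kernel `(t⁻¹)`), from the tree's `extRees_exists_quotient_equiv` and the weighted
  quasi-regularity of a cotangent-independent family (`weightedQuasiRegular_of_linearIndependent_toCotangent`,
  `CobordantBlowupRegularCentre`); `nbar`, `comap_rho_nbar`, `nbar_isPrime` as in res-type-098's K3a (p507345, the
  full-system case, whose `uT`, `algebraMap_u_eq`, `pow_mul_cancel_of_not_dvd` are reused).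
* `transform` — the saturated-transform candidate of `f = Σ_{β∈Δ} a_β u^β + r` with the remainder `r` in the WEIGHTED
  piece `𝒥_N` (for a partial system `𝔪^N ⊄ 𝒥_N`), `algebraMap_eq_tInv_pow_mul_transform`, `rho_transform` (the face
  polynomial `Σ_{w·β = m} ā_β X^β` over `A = S/(u)`), `transform_unique`.
* **`adicOrder_transform_le_of_isUnit_coeff`** / `iotaOrd_transform_le_of_isUnit_coeff` — if some `α ∈ Δ` of weight
  `m` carries a UNIT coefficient, then at every prime `𝔫 ∋ t⁻¹` of `B` and for every factorisation `f = (t⁻¹)^a g`,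
  `t⁻¹ ∤ g`: `ord_{B_𝔫} g ≤ Σ α_i` (part 1 `WeightedInitialFormOrder.adicOrder_le_degree_of_isUnit_coeff` over the
  coefficient ring `A`, whose units the unit `ā_α` of `A` stay at every prime).

[OURS · L1 W4.3] Replaces the role of NO printed item; NOT a statement of the manuscript
[claim: Hironaka2017, status: under-review]. AI work, weaker than expert review.

## References

* J. Włodarczyk, *Functorial resolution by torus actions*, arXiv:2203.03090, §2.3.9 (the exceptional divisor of the full
  cobordant blow-up is the weighted normal bundle `Spec (𝒪/(u))[u']`), Lemma 4.1.7. [Wlodarczyk2022]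
* res-L1-w43-plan-1, `IOTA3-DESIGN.md` v1 §5 ORDER (o33-a); res-type-005 (o28) `jCylinder` (OURS, AI planning).
-/

noncomputable section

open IsLocalRing Literature.AlgebraicGeometry.Resolution
open LaurentPolynomial
open scoped LaurentPolynomial
open Summit.ResolutionOfSingularities.ResolutionOfSingularities.Cruxes.HypersurfaceCentreConstruction.LocalEngine
  (iotaOrd iotaOrd_eq_ordOfENat_adicOrder ordOfENat ordOfENat_natCast ordOfENat_strictMono)
open Summit.ResolutionOfSingularities.ResolutionOfSingularities.Theorems.LocalGameEFTPointMove
  (uT coe_uT algebraMap_u_eq vertexIdeal_le_span_range_uT exists_uT_not_mem pow_mul_cancel_of_not_dvd)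
open Summit.ResolutionOfSingularities.ResolutionOfSingularities.Theorems.WeightedInitialFormOrder
open Summit.ResolutionOfSingularities.ResolutionOfSingularities.Theorems.OrderNonIncrease
  (C_mul_prod_X_pow_eq_monomial degree_equivFunOnFinite_symm face_isWeightedHomogeneous coeff_face)

set_option linter.dupNamespace false -- mandated namespace of this single-conjunct summit

namespace Summit.ResolutionOfSingularities.ResolutionOfSingularities.Theorems.OrderNonIncreasePartial

variable {S : Type} [CommRing S] {k : ℕ} (u : Fin k → S) (w : Fin k → ℕ)

/-! ## The exceptional chart for a partial regular system of parameters -/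

section Rho

variable [IsRegularLocalRing S] (hmem : ∀ i, u i ∈ maximalIdeal S)
  (hli : LinearIndependent (ResidueField S) fun i => (maximalIdeal S).toCotangent ⟨u i, hmem i⟩)
  (hw : ∀ i, 0 < w i)

include hli hw

/-- A cotangent-independent family with positive weights is weighted quasi-regular. [cite: Wlodarczyk2022, §2.3.9] -/
theorem hwqr (n : ℕ) (P : MvPolynomial (Fin k) S) (hP : P.IsWeightedHomogeneous w n)
    (heval : MvPolynomial.eval u P ∈ (weightedFiltration u w).ideal (n + 1)) (β : Fin k →₀ ℕ) :
    P.coeff β ∈ Ideal.span (Set.range u) :=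
  weightedQuasiRegular_of_linearIndependent_toCotangent u w hw hmem hli n P hP heval β

/-- The exceptional fibre ring: `B/(t⁻¹) ≃ (S/(u))[X₁,…,X_k]`, `uᵢ' ↦ Xᵢ`, `a ↦ ā`. [cite: Wlodarczyk2022, §2.3.9] -/
theorem exists_quotEquiv :
    ∃ e : (↥(extReesAlgebra (weightedMonomialIdeal u w)) ⧸
        Ideal.span {extReesAlgebra.tInv (weightedMonomialIdeal u w)}) ≃+*
        MvPolynomial (Fin k) (S ⧸ Ideal.span (Set.range u)),
      (∀ i, e (Ideal.Quotient.mk _ (uT u w i)) = MvPolynomial.X i) ∧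
      ∀ a : S, e (Ideal.Quotient.mk _ (algebraMap S _ a)) = MvPolynomial.C (Ideal.Quotient.mk _ a) :=
  extRees_exists_quotient_equiv (stub_extReesAlgebra_weighted u w) (uT u w) (fun _ => rfl) hw
    (hwqr u w hmem hli hw)

/-- The exceptional fibre isomorphism (a choice). [cite: Wlodarczyk2022, §2.3.9] -/
def quotEquiv : (↥(extReesAlgebra (weightedMonomialIdeal u w)) ⧸
    Ideal.span {extReesAlgebra.tInv (weightedMonomialIdeal u w)}) ≃+*
    MvPolynomial (Fin k) (S ⧸ Ideal.span (Set.range u)) :=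
  (exists_quotEquiv u w hmem hli hw).choose

/-- **The exceptional chart map** `rho : B → B/(t⁻¹) ≅ (S/(u))[X]` (partial system). [cite: Wlodarczyk2022, §2.3.9] -/
def rho : extReesAlgebra (weightedMonomialIdeal u w) →+* MvPolynomial (Fin k) (S ⧸ Ideal.span (Set.range u)) :=
  (quotEquiv u w hmem hli hw).toRingHom.comp (Ideal.Quotient.mk _)

/-- `rho uᵢ' = Xᵢ`. [folklore] -/
@[simp] theorem rho_uT (i : Fin k) : rho u w hmem hli hw (uT u w i) = MvPolynomial.X i :=
  (exists_quotEquiv u w hmem hli hw).choose_spec.1 i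

/-- `rho a = ā`. [folklore] -/
@[simp] theorem rho_algebraMap (a : S) :
    rho u w hmem hli hw (algebraMap S _ a) = MvPolynomial.C (Ideal.Quotient.mk _ a) :=
  (exists_quotEquiv u w hmem hli hw).choose_spec.2 a

/-- `rho t⁻¹ = 0`. [folklore] -/
@[simp] theorem rho_tInv : rho u w hmem hli hw (extReesAlgebra.tInv (weightedMonomialIdeal u w)) = 0 := by
  rw [rho, RingHom.comp_apply, Ideal.Quotient.eq_zero_iff_mem.mpr (Ideal.mem_span_singleton_self _), map_zero]

/-- `rho` is surjective. [folklore] -/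
theorem rho_surjective : Function.Surjective (rho u w hmem hli hw) :=
  (quotEquiv u w hmem hli hw).surjective.comp Ideal.Quotient.mk_surjective

/-- `ker rho = (t⁻¹)`. [folklore] -/
theorem ker_rho :
    RingHom.ker (rho u w hmem hli hw) = Ideal.span {extReesAlgebra.tInv (weightedMonomialIdeal u w)} := by
  ext b
  rw [RingHom.mem_ker, rho, RingHom.comp_apply, RingEquiv.toRingHom_eq_coe, RingHom.coe_coe,
    EmbeddingLike.map_eq_zero_iff, Ideal.Quotient.eq_zero_iff_mem]

variable (𝔫 : Ideal (extReesAlgebra (weightedMonomialIdeal u w)))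
  (hT : extReesAlgebra.tInv (weightedMonomialIdeal u w) ∈ 𝔫)

/-- The image `nbar = rho(𝔫)` of an ideal of `B`. [folklore] -/
abbrev nbar : Ideal (MvPolynomial (Fin k) (S ⧸ Ideal.span (Set.range u))) := 𝔫.map (rho u w hmem hli hw)

include hT

/-- `ker rho ⊆ 𝔫` when `t⁻¹ ∈ 𝔫`. [folklore] -/
theorem ker_rho_le : RingHom.ker (rho u w hmem hli hw) ≤ 𝔫 := by
  rw [ker_rho, Ideal.span_singleton_le_iff_mem]
  exact hT

/-- `rho⁻¹(nbar) = 𝔫`. [folklore] -/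
theorem comap_rho_nbar : (nbar u w hmem hli hw 𝔫).comap (rho u w hmem hli hw) = 𝔫 := by
  show Ideal.comap _ (Ideal.map _ 𝔫) = 𝔫
  rw [Ideal.comap_map_of_surjective' _ (rho_surjective u w hmem hli hw)]
  exact sup_eq_left.mpr (ker_rho_le u w hmem hli hw 𝔫 hT)

variable [𝔫.IsPrime]

/-- `nbar` is prime. [folklore] -/
theorem nbar_isPrime : (nbar u w hmem hli hw 𝔫).IsPrime :=
  Ideal.map_isPrime_of_surjective (rho_surjective u w hmem hli hw) (ker_rho_le u w hmem hli hw 𝔫 hT)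

end Rho

/-! ## The saturated transform with a remainder in the weighted piece `𝒥_N` -/

section Transform

/-- The remainder lift: for `r ∈ 𝒥_N` (`N ≥ 1`) the element `r t^N ∈ B`. [folklore] -/
def rT {N : ℕ} (hN : 0 < N) {r : S} (hr : r ∈ weightedMonomialIdeal u w N) :
    extReesAlgebra (weightedMonomialIdeal u w) :=
  ⟨C r * T (N : ℤ), extReesAlgebra.C_mul_T_mem _ hN hr⟩

/-- `r = (t⁻¹)^N · (r t^N)`. [folklore] -/
theorem algebraMap_eq_tInv_pow_mul_rT {N : ℕ} (hN : 0 < N) {r : S} (hr : r ∈ weightedMonomialIdeal u w N) :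
    algebraMap S (extReesAlgebra (weightedMonomialIdeal u w)) r =
      extReesAlgebra.tInv (weightedMonomialIdeal u w) ^ N * rT u w hN hr := by
  apply Subtype.ext
  rw [Subalgebra.coe_algebraMap, ← C_eq_algebraMap, MulMemClass.coe_mul, SubmonoidClass.coe_pow,
    extReesAlgebra.coe_tInv, T_pow, rT, mul_left_comm, ← T_add]
  simp

/-- The saturated-transform candidate of `f = Σ_{α∈Δ} a_α u^α + r`, `r ∈ 𝒥_N`:
`G = Σ_{α∈Δ} a_α (t⁻¹)^{w·α−m} u'^α + (t⁻¹)^{N−m} (r t^N)`. [folklore] -/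
def transform (Δ : Finset (Fin k → ℕ)) (a : (Fin k → ℕ) → S) (m : ℕ) {N : ℕ} (hN : 0 < N) {r : S}
    (hr : r ∈ weightedMonomialIdeal u w N) : extReesAlgebra (weightedMonomialIdeal u w) :=
  ∑ α ∈ Δ, algebraMap S _ (a α) * extReesAlgebra.tInv (weightedMonomialIdeal u w) ^ (∑ i, w i * α i - m) *
      ∏ i, uT u w i ^ α i +
    extReesAlgebra.tInv (weightedMonomialIdeal u w) ^ (N - m) * rT u w hN hr

/-- **`f = (t⁻¹)ᵐ · G`** for `f = Σ_{α∈Δ} a_α u^α + r`, `m ≤ w·α` on `Δ`, `m ≤ N`. [cite: Wlodarczyk2022, §3.3] -/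
theorem algebraMap_eq_tInv_pow_mul_transform (Δ : Finset (Fin k → ℕ)) (a : (Fin k → ℕ) → S) (m : ℕ) {N : ℕ}
    (hN : 0 < N) {r : S} (hr : r ∈ weightedMonomialIdeal u w N) (hm : ∀ α ∈ Δ, m ≤ ∑ i, w i * α i) (hmN : m ≤ N)
    {f : S} (hf : f = ∑ α ∈ Δ, a α * ∏ i, u i ^ α i + r) :
    algebraMap S (extReesAlgebra (weightedMonomialIdeal u w)) f =
      extReesAlgebra.tInv (weightedMonomialIdeal u w) ^ m * transform u w Δ a m hN hr := by
  rw [hf, map_add, map_sum, transform, mul_add, Finset.mul_sum, ← mul_assoc, ← pow_add, Nat.add_sub_cancel' hmN,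
    ← algebraMap_eq_tInv_pow_mul_rT u w hN hr]
  congr 1
  refine Finset.sum_congr rfl fun α hα => ?_
  rw [map_mul, map_prod]
  simp_rw [map_pow, algebraMap_u_eq u w, mul_pow, Finset.prod_mul_distrib, ← pow_mul, Finset.prod_pow_eq_pow_sum]
  rw [show (∑ i, w i * α i) = m + (∑ i, w i * α i - m) from (Nat.add_sub_cancel' (hm α hα)).symm, pow_add,
    Nat.add_sub_cancel_left]
  ring

variable [IsRegularLocalRing S] (hmem : ∀ i, u i ∈ maximalIdeal S)
  (hli : LinearIndependent (ResidueField S) fun i => (maximalIdeal S).toCotangent ⟨u i, hmem i⟩)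
  (hw : ∀ i, 0 < w i)

include hli hw in
/-- **The image of `G` in the exceptional chart is the face polynomial** `Φ = Σ_{α∈Δ, w·α = m} ā_α X^α` over
`A = S/(u)` (for `m < N`). [cite: Wlodarczyk2022, Lemma 4.1.7] -/
theorem rho_transform (Δ : Finset (Fin k → ℕ)) (a : (Fin k → ℕ) → S) (m : ℕ) {N : ℕ} (hN : 0 < N) {r : S}
    (hr : r ∈ weightedMonomialIdeal u w N) (hm : ∀ α ∈ Δ, m ≤ ∑ i, w i * α i) (hmN : m < N) :
    rho u w hmem hli hw (transform u w Δ a m hN hr) =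
      ∑ α ∈ Δ.filter (fun α : Fin k → ℕ => ∑ i, w i * α i = m),
        (MvPolynomial.C (Ideal.Quotient.mk _ (a α)) * ∏ i, MvPolynomial.X i ^ α i :
          MvPolynomial (Fin k) (S ⧸ Ideal.span (Set.range u))) := by
  classical
  rw [transform, map_add, map_sum, map_mul, map_pow, rho_tInv, zero_pow (by omega), zero_mul, add_zero,
    Finset.sum_filter]
  refine Finset.sum_congr rfl fun α hα => ?_
  rw [map_mul, map_mul, map_pow, map_prod, rho_tInv, rho_algebraMap]
  simp_rw [map_pow, rho_uT]
  split_ifs with h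
  · rw [h, Nat.sub_self, pow_zero, mul_one]
  · have hlt : m < ∑ i, w i * α i := lt_of_le_of_ne (hm α hα) (Ne.symm h)
    rw [zero_pow (by omega), mul_zero, zero_mul]

include hmem hli hw in
/-- **Uniqueness of the saturated transform** (partial system): if the face polynomial is non-zero then every
factorisation `f = (t⁻¹)ᵃ g` with `t⁻¹ ∤ g` has `a = m` and `g = G`. [cite: Wlodarczyk2022, §3.3] -/
theorem transform_unique (Δ : Finset (Fin k → ℕ)) (a : (Fin k → ℕ) → S) (m : ℕ) {N : ℕ} (hN : 0 < N) {r : S}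
    (hr : r ∈ weightedMonomialIdeal u w N) (hm : ∀ α ∈ Δ, m ≤ ∑ i, w i * α i) (hmN : m < N)
    {f : S} (hf : f = ∑ α ∈ Δ, a α * ∏ i, u i ^ α i + r)
    (hΦ : rho u w hmem hli hw (transform u w Δ a m hN hr) ≠ 0)
    {a' : ℕ} {g : extReesAlgebra (weightedMonomialIdeal u w)}
    (hfg : algebraMap S (extReesAlgebra (weightedMonomialIdeal u w)) f =
      extReesAlgebra.tInv (weightedMonomialIdeal u w) ^ a' * g)
    (hndvd : ¬ extReesAlgebra.tInv (weightedMonomialIdeal u w) ∣ g) :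
    a' = m ∧ g = transform u w Δ a m hN hr := by
  haveI := isDomain_of_isRegularLocalRing S
  have hG : ¬ extReesAlgebra.tInv (weightedMonomialIdeal u w) ∣ transform u w Δ a m hN hr := by
    rintro ⟨c, hc⟩
    apply hΦ
    rw [hc, map_mul, rho_tInv, zero_mul]
  have h0 : extReesAlgebra.tInv (weightedMonomialIdeal u w) ≠ 0 := by
    intro h
    have h' := congrArg Subtype.val h
    rw [extReesAlgebra.coe_tInv, ZeroMemClass.coe_zero] at h'
    exact (isUnit_T (R := S) (-1 : ℤ)).ne_zero h'
  rw [algebraMap_eq_tInv_pow_mul_transform u w Δ a m hN hr hm hmN.le hf] at hfg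
  exact pow_mul_cancel_of_not_dvd h0 hfg.symm hndvd hG

end Transform

/-! ## The order of the saturated transform at every successor point (partial system) -/

section Successor

variable [IsRegularLocalRing S] (hmem : ∀ i, u i ∈ maximalIdeal S)
  (hli : LinearIndependent (ResidueField S) fun i => (maximalIdeal S).toCotangent ⟨u i, hmem i⟩)
  (hw : ∀ i, 0 < w i)

include hli hw

/-- **(o33-a) «ν does not rise» for centres of positive dimension, `adicOrder` form.**  `S` regular local,
`u : Fin k → S` part of a regular system of parameters (cotangent-independent) with positive weights `w`,
`f = Σ_{β∈Δ} a_β u^β + r`, `r ∈ 𝒥_N`, `ℓ ≤ w·β` on `Δ`, `ℓ < N`, and some `α ∈ Δ` with `w·α = ℓ` and `a_α` a UNIT of `S`.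
Then at every prime `𝔫 ∋ t⁻¹` of the cobordant algebra and for every factorisation `f = (t⁻¹)^a g`, `t⁻¹ ∤ g`:
`ord_{B_𝔫} g ≤ Σ α_i`. [OURS · L1 W4.3 · ORDER (o33-a)] [cite: Wlodarczyk2022, Lemma 4.1.7] -/
theorem adicOrder_transform_le_of_isUnit_coeff (Δ : Finset (Fin k → ℕ)) (a : (Fin k → ℕ) → S) (ℓ : ℕ)
    {N : ℕ} (hN : 0 < N) {r : S} (hr : r ∈ weightedMonomialIdeal u w N) (hm : ∀ β ∈ Δ, ℓ ≤ ∑ i, w i * β i)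
    (hℓN : ℓ < N) {f : S} (hf : f = ∑ β ∈ Δ, a β * ∏ i, u i ^ β i + r)
    {α : Fin k → ℕ} (hα : α ∈ Δ) (hwα : ∑ i, w i * α i = ℓ) (hunit : IsUnit (a α))
    (𝔫 : Ideal (extReesAlgebra (weightedMonomialIdeal u w))) [𝔫.IsPrime]
    (hT : extReesAlgebra.tInv (weightedMonomialIdeal u w) ∈ 𝔫)
    {a' : ℕ} {g : extReesAlgebra (weightedMonomialIdeal u w)}
    (hfg : algebraMap S (extReesAlgebra (weightedMonomialIdeal u w)) f =
      extReesAlgebra.tInv (weightedMonomialIdeal u w) ^ a' * g)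
    (hndvd : ¬ extReesAlgebra.tInv (weightedMonomialIdeal u w) ∣ g) :
    adicOrder (algebraMap _ (Localization.AtPrime 𝔫) g) ≤ ((∑ i, α i : ℕ) : ℕ∞) := by
  classical
  -- the ring of the centre `S/(u)` is non-trivial
  haveI : Nontrivial (S ⧸ Ideal.span (Set.range u)) :=
    Ideal.Quotient.nontrivial_iff.mpr (ne_top_of_le_ne_top (maximalIdeal.isMaximal S).ne_top
      (Ideal.span_le.mpr (by rintro _ ⟨i, rfl⟩; exact hmem i)))
  set Φ := rho u w hmem hli hw (transform u w Δ a ℓ hN hr) with hΦdef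
  have hΦeq := rho_transform u w hmem hli hw Δ a ℓ hN hr hm hℓN
  have hcoeff : MvPolynomial.coeff (Finsupp.equivFunOnFinite.symm α) Φ = Ideal.Quotient.mk _ (a α) := by
    rw [hΦdef, hΦeq]
    exact coeff_face w Δ _ ℓ hα hwα
  have hunit' : IsUnit (MvPolynomial.coeff (Finsupp.equivFunOnFinite.symm α) Φ) := by
    rw [hcoeff]
    exact hunit.map _
  have hΦwh : Φ.IsWeightedHomogeneous w ℓ := by
    rw [hΦdef, hΦeq]
    exact face_isWeightedHomogeneous w Δ _ ℓ
  have hΦ0 : Φ ≠ 0 := fun h => hunit'.ne_zero (by rw [h, MvPolynomial.coeff_zero])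
  obtain ⟨-, rfl⟩ := transform_unique u w hmem hli hw Δ a ℓ hN hr hm hℓN hf hΦ0 hfg hndvd
  haveI h𝔫' : (nbar u w hmem hli hw 𝔫).IsPrime := nbar_isPrime u w hmem hli hw 𝔫 hT
  have hcomap : 𝔫 = (nbar u w hmem hli hw 𝔫).comap (rho u w hmem hli hw) :=
    (comap_rho_nbar u w hmem hli hw 𝔫 hT).symm
  set φ := Localization.localRingHom 𝔫 (nbar u w hmem hli hw 𝔫) (rho u w hmem hli hw) hcomap with hφ
  haveI : IsLocalHom φ := Localization.isLocalHom_localRingHom 𝔫 _ _ hcomap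
  have h1 := adicOrder_le_adicOrder_map (R := Localization.AtPrime 𝔫)
    (S := Localization.AtPrime (nbar u w hmem hli hw 𝔫)) φ
    (algebraMap _ (Localization.AtPrime 𝔫) (transform u w Δ a ℓ hN hr))
  rw [hφ, Localization.localRingHom_to_map] at h1
  refine h1.trans ?_
  have h2 := adicOrder_le_degree_of_isUnit_coeff hw hΦwh hunit' (nbar u w hmem hli hw 𝔫)
  rwa [degree_equivFunOnFinite_symm] at h2

/-- **(o33-a) «ν does not rise» for centres of positive dimension, `iotaOrd` form.**
[OURS · L1 W4.3 · ORDER (o33-a)] [cite: Wlodarczyk2022, Lemma 4.1.7] -/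
theorem iotaOrd_transform_le_of_isUnit_coeff (Δ : Finset (Fin k → ℕ)) (a : (Fin k → ℕ) → S) (ℓ : ℕ)
    {N : ℕ} (hN : 0 < N) {r : S} (hr : r ∈ weightedMonomialIdeal u w N) (hm : ∀ β ∈ Δ, ℓ ≤ ∑ i, w i * β i)
    (hℓN : ℓ < N) {f : S} (hf : f = ∑ β ∈ Δ, a β * ∏ i, u i ^ β i + r)
    {α : Fin k → ℕ} (hα : α ∈ Δ) (hwα : ∑ i, w i * α i = ℓ) (hunit : IsUnit (a α))
    (𝔫 : Ideal (extReesAlgebra (weightedMonomialIdeal u w))) [𝔫.IsPrime]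
    (hT : extReesAlgebra.tInv (weightedMonomialIdeal u w) ∈ 𝔫)
    {a' : ℕ} {g : extReesAlgebra (weightedMonomialIdeal u w)}
    (hfg : algebraMap S (extReesAlgebra (weightedMonomialIdeal u w)) f =
      extReesAlgebra.tInv (weightedMonomialIdeal u w) ^ a' * g)
    (hndvd : ¬ extReesAlgebra.tInv (weightedMonomialIdeal u w) ∣ g) :
    iotaOrd (Localization.AtPrime 𝔫) (algebraMap _ (Localization.AtPrime 𝔫) g) ≤ ((∑ i, α i : ℕ) : Ordinal) := by
  have h := adicOrder_transform_le_of_isUnit_coeff u w hmem hli hw Δ a ℓ hN hr hm hℓN hf hα hwα hunit 𝔫 hT hfg hndvd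
  rw [iotaOrd_eq_ordOfENat_adicOrder, ← ordOfENat_natCast]
  exact ordOfENat_strictMono.monotone h

end Successor

end Summit.ResolutionOfSingularities.ResolutionOfSingularities.Theorems.OrderNonIncreasePartial
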